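import Summits.QuantumFields.YangMills.Theorems.SmallFieldWideningLargeFieldMassRefinementTailStubBoundedHeight

/-!
# Route `SmallFieldWidening`, crux r3 `LargeFieldMassRefinementTail` (stmt-QuantumFields-22884), line `birth` v6 — THE SHARED STUB (hence cruxes 22884, 26243,
# 19936) FROM A ONE-STEP, ONE-SIDED UV-STABILITY OF THE UNIT-PLAQUETTE TAIL, uniform in the volume («one more ultraviolet level multiplies the probability of
# a large unit plaquette of the fully averaged field by at most `e^{ρ_K}`, `Σ_K ρ_K` bounded»)
# (support file; width seat `ym-line-sfw-p2-w2` gen 17; the stub, the three cruxes and rung R3 stay OPEN)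

WHAT THIS IS NOT.  No estimate of Bałaban's programme is proved; nothing bears on the Yang–Mills mass gap; rung R3 (`YM3TorusSU2`) is a RECORD rung.  This is the
VOLUME-UNIFORM twin of the companion reduction `…CondStab` (which is per family and conditional on the small sub-unit history, and serves r3 only):

`PlainStab` (hypothesis of ★ `unitTop_of_plainStab`): for every `L, b₀, p₀` there are `γ₁ ∈ (0,1]` and accumulated slacks `A_η` (`∀ η > 0`) such that for every family `F`
(`F.L = L`, ANY volume), every `0 < γ ≤ γ₁` and every unit plaquette label `q` there are one-step slacks `ρ_K` with `Σ_{1 ≤ k < K} ρ_k ≤ A_η + η·p_{b₀}(√γ)²` and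
          `Gibbs_{K+1}{ θ_{b₀}(0) ≤ |Ū^{K+1}(∂q) − 1| } ≤ exp(ρ_K) · Gibbs_K{ θ_{b₀}(0) ≤ |Ū^K(∂q) − 1| }`      for every `K ≥ 1`
— runs `K+1` and `K` of the same family at the same unit coupling; no conditioning.  In the lattice-Maxwell caricature the large-deviation cost of this (and every) coarse
event is monotone under adding levels (`…CondStabMaxwellRung.ldCost_mono_T3_one`), i.e. `ρ ≡ 0` there; kit j291705's unit variances `0.2541 > 0.2153 > 0.2110 > 0.2105`.

THEN (§1) the window-free height-free unit-top tail `UnitTop` holds with constants uniform in the family — chain down to the ONE-step run, whose unit-plaquette tail is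
bounded UNCONDITIONALLY and volume-uniformly by the companion `FirstExitDeepBoundedHeight.perPlaquette_boundedHeight_uniform` (`j₀ = 1`: box-locality + bare tail) — hence
(§2, the landed normal form `…UnitTop.deepStub_iff_unitTop` and certificates) the registered stub `stub_firstExitDeep`, `FirstExitWindowTailL` (stmt-QuantumFields-26243),
`LargeFieldMassRefinementTail` (stmt-QuantumFields-22884) and `HistoryTailL` (stmt-QuantumFields-19936) BY NAME.  Unlike `CondStab`, the hypothesis sees the large-field
part of the unit law too (no history conditioning) — the price of volume-uniformity (the global small history is rare on large tori, so conditional chaining has no uniform base).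

References: T. Bałaban, Commun. Math. Phys. **102** (1985) 255–275 [Balaban1985UV3] ((7) p.257, (70)–(71) p.273); CMP **109** (1987) 249–301 [Balaban1987RG1] (Thm 1 p.259).
-/

noncomputable section

open MeasureTheory Filter Topology
open scoped BigOperators
open Literature.MathematicalPhysics.QuantumFieldTheory.Balaban1983to89
open Literature.MathematicalPhysics.QuantumFieldTheory.Balaban1983to89.Missing
open Literature.MathematicalPhysics.QuantumFieldTheory.Balaban1983to89.T3ContinuumYM3Torus
open Literature.MathematicalPhysics.QuantumFieldTheory.Balaban1983to89.T3UnitScaleTilt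
open Literature.MathematicalPhysics.QuantumFieldTheory.Balaban1983to89.T3UnitLawDensityEML (ℰp)
open Literature.MathematicalPhysics.QuantumFieldTheory.Balaban1983to89.T3LevelShift
open Summit.QuantumFields.YangMills.Theorems.FirstExitDeepBoundedHeight (perPlaquette_boundedHeight_uniform)
open Summit.QuantumFields.YangMills.Theorems.LargeFieldMassRefinementTailUnitTop
  (deepStub_iff_unitTop firstExitWindowTailL_of_unitTop largeFieldMassRefinementTail_of_unitTop historyTailL_of_unitTop)

namespace Summit.QuantumFields.YangMills.Theorems.LargeFieldMassRefinementTailPlainStab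

/-- Chaining from `K = 1`: `c_{K+1} ≤ e^{ρ_K} c_K` for `K ≥ 1` gives `c_K ≤ exp(Σ_{1≤k<K} ρ_k)·c_1`. [folklore] -/
theorem chain_le_one {c ρ : ℕ → ℝ} (h : ∀ K, 1 ≤ K → c (K + 1) ≤ Real.exp (ρ K) * c K) :
    ∀ K, 1 ≤ K → c K ≤ Real.exp (∑ k ∈ Finset.Ico 1 K, ρ k) * c 1 := by
  intro K hK
  induction K, hK using Nat.le_induction with
  | base => simp
  | succ K hK ih =>
    calc c (K + 1) ≤ Real.exp (ρ K) * c K := h K hK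
      _ ≤ Real.exp (ρ K) * (Real.exp (∑ k ∈ Finset.Ico 1 K, ρ k) * c 1) :=
          mul_le_mul_of_nonneg_left ih (Real.exp_nonneg _)
      _ = Real.exp (∑ k ∈ Finset.Ico 1 (K + 1), ρ k) * c 1 := by
          rw [Finset.sum_Ico_succ_top hK, Real.exp_add]; ring

/-! ## §1 `UnitTop`, uniformly in the family, from the one-step stability of the unit-plaquette tail -/

/-- ★ **THE WINDOW-FREE HEIGHT-FREE UNIT-TOP TAIL (uniform constants) FROM `PlainStab`.**  See the module docstring for `PlainStab`; the conclusion is the right-hand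
side of `LargeFieldMassRefinementTailUnitTop.deepStub_iff_unitTop`. [cite: Balaban1985UV3, (7) p.257 and (70)-(71) p.273; Balaban1987RG1, Thm 1 p.259] -/
theorem unitTop_of_plainStab
    (hPS : ∀ (L : ℕ) (b₀ p₀ : ℝ), 0 < b₀ → 2 < p₀ → ∃ γ₁ : ℝ, 0 < γ₁ ∧ γ₁ ≤ 1 ∧
      ∀ η : ℝ, 0 < η → ∃ A : ℝ, ∀ (F : T3Family) (γ : ℝ), F.L = L → 0 < γ → γ ≤ γ₁ →
        ∀ q : Plaq (F.P 0) 0, ∃ ρ : ℕ → ℝ,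
          (∀ K : ℕ, ∑ k ∈ Finset.Ico 1 K, ρ k ≤ A + η * B10.pFun b₀ p₀ (Real.sqrt γ) ^ 2) ∧
          ∀ K : ℕ, 1 ≤ K →
            (gibbsK F ℰp γ (K + 1)).real {U | θBal F.L γ b₀ p₀ 0 ≤ GaugeGroup.dist1 (GaugeField.plaqHol
                (Averaging.iter (fun i => BlockAveraging.blockAvg (P := F.P (K + 1)) (j := i) ℰp) (K + 1) U)
                (plaqShift (F.sitesPerDir_unit (K + 1)) q))} ≤
            Real.exp (ρ K) *
            (gibbsK F ℰp γ K).real {U | θBal F.L γ b₀ p₀ 0 ≤ GaugeGroup.dist1 (GaugeField.plaqHol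
                (Averaging.iter (fun i => BlockAveraging.blockAvg (P := F.P K) (j := i) ℰp) K U)
                (plaqShift (F.sitesPerDir_unit K) q))}) :
    ∀ (L : ℕ) (b₀ p₀ : ℝ), 0 < b₀ → 2 < p₀ → ∃ (γ₁ C c : ℝ) (N : ℕ), 0 < γ₁ ∧ γ₁ ≤ 1 ∧ 0 < c ∧ 0 ≤ C ∧
      ∀ (F : T3Family) (γ : ℝ), F.L = L → 0 < γ → γ ≤ γ₁ → ∀ (K : ℕ), 2 ≤ K → ∀ p : Plaq (F.P K) K,
        (gibbsK F ℰp γ K).real {U | (∀ k, k < K → PlaqSmall (θBal F.L γ b₀ p₀ (K - k))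
            (Averaging.iter (fun i => BlockAveraging.blockAvg (P := F.P K) (j := i) ℰp) k U)) ∧
          θBal F.L γ b₀ p₀ 0 ≤ GaugeGroup.dist1 (GaugeField.plaqHol
            (Averaging.iter (fun i => BlockAveraging.blockAvg (P := F.P K) (j := i) ℰp) K U) p)} ≤
        C * (γ⁻¹) ^ N * Real.exp (-(c * B10.pFun b₀ p₀ (Real.sqrt γ) ^ 2)) := by
  intro L b₀ p₀ hb₀ hp₀
  -- the volume-uniform one-step base
  obtain ⟨γb, C_b, c_b, N_b, hγb, hγb1, hc_b, hC_b, hbase⟩ := perPlaquette_boundedHeight_uniform 1 L b₀ p₀ hb₀ (by linarith)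
  obtain ⟨γs, hγs, hγs1, hslack⟩ := hPS L b₀ p₀ hb₀ hp₀
  obtain ⟨A, hA⟩ := hslack (c_b / 2) (half_pos hc_b)
  refine ⟨min γb γs, C_b * Real.exp A, c_b / 2, N_b, lt_min hγb hγs, (min_le_left _ _).trans hγb1, half_pos hc_b, by positivity,
    fun F γ hFL hγ hle K hK p => ?_⟩
  haveI := isProbabilityMeasure_gibbsK F ℰp hγ.le K
  -- the label of `p` and the chained one-step bounds
  set q : Plaq (F.P 0) 0 := (plaqShift (F.sitesPerDir_unit K)).symm p with hq
  obtain ⟨ρ, hρ, hstep⟩ := hA F γ hFL hγ (hle.trans (min_le_right _ _)) q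
  have hch := chain_le_one (ρ := ρ)
    (c := fun K' => (gibbsK F ℰp γ K').real {U | θBal F.L γ b₀ p₀ 0 ≤ GaugeGroup.dist1 (GaugeField.plaqHol
      (Averaging.iter (fun i => BlockAveraging.blockAvg (P := F.P K') (j := i) ℰp) K' U) (plaqShift (F.sitesPerDir_unit K') q))})
    hstep K (by omega)
  beta_reduce at hch
  have hpq : plaqShift (F.sitesPerDir_unit K) q = p := (plaqShift (F.sitesPerDir_unit K)).apply_symm_apply p
  rw [hpq] at hch
  -- the base at `K = 1` (height `1` of run `1`, `1 − 1 = 0`)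
  have hb := hbase F γ hFL hγ (hle.trans (min_le_left _ _)) 1 1 le_rfl le_rfl (plaqShift (F.sitesPerDir_unit 1) q)
  simp only [Nat.sub_self, pow_zero, mul_one] at hb
  -- assemble
  have hexp : Real.exp (∑ k ∈ Finset.Ico 1 K, ρ k) ≤ Real.exp (A + c_b / 2 * B10.pFun b₀ p₀ (Real.sqrt γ) ^ 2) :=
    Real.exp_le_exp.mpr (hρ K)
  refine (measureReal_mono (fun U hU => hU.2) (measure_ne_top _ _)).trans (hch.trans ?_)
  refine (mul_le_mul hexp hb measureReal_nonneg (Real.exp_nonneg _)).trans (le_of_eq ?_)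
  have hsplit : Real.exp (A + c_b / 2 * B10.pFun b₀ p₀ (Real.sqrt γ) ^ 2) * Real.exp (-(c_b * B10.pFun b₀ p₀ (Real.sqrt γ) ^ 2)) =
      Real.exp A * Real.exp (-(c_b / 2 * B10.pFun b₀ p₀ (Real.sqrt γ) ^ 2)) := by
    rw [← Real.exp_add, ← Real.exp_add]; ring_nf
  calc Real.exp (A + c_b / 2 * B10.pFun b₀ p₀ (Real.sqrt γ) ^ 2) * (C_b * (γ⁻¹) ^ N_b * Real.exp (-(c_b * B10.pFun b₀ p₀ (Real.sqrt γ) ^ 2)))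
      = C_b * (γ⁻¹) ^ N_b * (Real.exp (A + c_b / 2 * B10.pFun b₀ p₀ (Real.sqrt γ) ^ 2) *
          Real.exp (-(c_b * B10.pFun b₀ p₀ (Real.sqrt γ) ^ 2))) := by ring
    _ = C_b * Real.exp A * (γ⁻¹) ^ N_b * Real.exp (-(c_b / 2 * B10.pFun b₀ p₀ (Real.sqrt γ) ^ 2)) := by rw [hsplit]; ring

/-! ## §2 The stub and the three cruxes by name -/

/-- ★★ **THE REGISTERED STUB `stub_firstExitDeep` (text verbatim) FROM `PlainStab`** (via `unitTop_of_plainStab` and the landed normal form `deepStub_iff_unitTop`).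
Conditional certificate; `PlainStab` is NOT proved; nothing about the mass gap. [cite: Balaban1985UV3, (7) p.257 and (70)-(71) p.273] -/
theorem deepStub_of_plainStab
    (hPS : ∀ (L : ℕ) (b₀ p₀ : ℝ), 0 < b₀ → 2 < p₀ → ∃ γ₁ : ℝ, 0 < γ₁ ∧ γ₁ ≤ 1 ∧
      ∀ η : ℝ, 0 < η → ∃ A : ℝ, ∀ (F : T3Family) (γ : ℝ), F.L = L → 0 < γ → γ ≤ γ₁ →
        ∀ q : Plaq (F.P 0) 0, ∃ ρ : ℕ → ℝ,
          (∀ K : ℕ, ∑ k ∈ Finset.Ico 1 K, ρ k ≤ A + η * B10.pFun b₀ p₀ (Real.sqrt γ) ^ 2) ∧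
          ∀ K : ℕ, 1 ≤ K →
            (gibbsK F ℰp γ (K + 1)).real {U | θBal F.L γ b₀ p₀ 0 ≤ GaugeGroup.dist1 (GaugeField.plaqHol
                (Averaging.iter (fun i => BlockAveraging.blockAvg (P := F.P (K + 1)) (j := i) ℰp) (K + 1) U)
                (plaqShift (F.sitesPerDir_unit (K + 1)) q))} ≤
            Real.exp (ρ K) *
            (gibbsK F ℰp γ K).real {U | θBal F.L γ b₀ p₀ 0 ≤ GaugeGroup.dist1 (GaugeField.plaqHol
                (Averaging.iter (fun i => BlockAveraging.blockAvg (P := F.P K) (j := i) ℰp) K U)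
                (plaqShift (F.sitesPerDir_unit K) q))}) :
    ∀ (L : ℕ) (b₀ p₀ b₂ : ℝ), 0 < b₀ → 2 < p₀ → b₀ ≤ b₂ → ∃ (γ₁ C c : ℝ) (N : ℕ), 0 < γ₁ ∧ γ₁ ≤ 1 ∧ 0 < c ∧ 0 ≤ C ∧
      ∀ (F : T3Family) (γ : ℝ), F.L = L → 0 < γ → γ ≤ γ₁ → ∀ (K j : ℕ), 2 ≤ j → j ≤ K → ∀ p : Plaq (F.P K) j,
        (gibbsK F ℰp γ K).real {U | (∀ k, k < j → PlaqSmall (θBal F.L γ b₀ p₀ (K - k))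
            (Averaging.iter (fun i => BlockAveraging.blockAvg (P := F.P K) (j := i) ℰp) k U)) ∧
          PlaqSmall (θBal F.L γ b₂ p₀ (K - j)) (Averaging.iter (fun i => BlockAveraging.blockAvg (P := F.P K) (j := i) ℰp) j U) ∧
          θBal F.L γ b₀ p₀ (K - j) ≤ GaugeGroup.dist1 (GaugeField.plaqHol
            (Averaging.iter (fun i => BlockAveraging.blockAvg (P := F.P K) (j := i) ℰp) j U) p)} ≤
        C * ((γ * ((F.L : ℝ)⁻¹) ^ (K - j))⁻¹) ^ N * Real.exp (-(c * B10.pFun b₀ p₀ (Real.sqrt (γ * ((F.L : ℝ)⁻¹) ^ (K - j))) ^ 2)) :=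
  deepStub_iff_unitTop.mpr (unitTop_of_plainStab hPS)

/-- **`FirstExitWindowTailL` (stmt-QuantumFields-26243) ⇐ `PlainStab`.**  Conditional certificate. [cite: Balaban1985UV3, (70)-(71) p.273] -/
theorem firstExitWindowTailL_of_plainStab
    (hPS : ∀ (L : ℕ) (b₀ p₀ : ℝ), 0 < b₀ → 2 < p₀ → ∃ γ₁ : ℝ, 0 < γ₁ ∧ γ₁ ≤ 1 ∧
      ∀ η : ℝ, 0 < η → ∃ A : ℝ, ∀ (F : T3Family) (γ : ℝ), F.L = L → 0 < γ → γ ≤ γ₁ →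
        ∀ q : Plaq (F.P 0) 0, ∃ ρ : ℕ → ℝ,
          (∀ K : ℕ, ∑ k ∈ Finset.Ico 1 K, ρ k ≤ A + η * B10.pFun b₀ p₀ (Real.sqrt γ) ^ 2) ∧
          ∀ K : ℕ, 1 ≤ K →
            (gibbsK F ℰp γ (K + 1)).real {U | θBal F.L γ b₀ p₀ 0 ≤ GaugeGroup.dist1 (GaugeField.plaqHol
                (Averaging.iter (fun i => BlockAveraging.blockAvg (P := F.P (K + 1)) (j := i) ℰp) (K + 1) U)
                (plaqShift (F.sitesPerDir_unit (K + 1)) q))} ≤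
            Real.exp (ρ K) *
            (gibbsK F ℰp γ K).real {U | θBal F.L γ b₀ p₀ 0 ≤ GaugeGroup.dist1 (GaugeField.plaqHol
                (Averaging.iter (fun i => BlockAveraging.blockAvg (P := F.P K) (j := i) ℰp) K U)
                (plaqShift (F.sitesPerDir_unit K) q))}) :
    Summit.QuantumFields.YangMills.Theses.FirstExitWindow.FirstExitWindowTailL :=
  firstExitWindowTailL_of_unitTop (unitTop_of_plainStab hPS)

/-- **r3 `LargeFieldMassRefinementTail` (stmt-QuantumFields-22884) ⇐ `PlainStab`.**  Conditional certificate. [cite: Balaban1985UV3, (70)-(71) p.273] -/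
theorem largeFieldMassRefinementTail_of_plainStab
    (hPS : ∀ (L : ℕ) (b₀ p₀ : ℝ), 0 < b₀ → 2 < p₀ → ∃ γ₁ : ℝ, 0 < γ₁ ∧ γ₁ ≤ 1 ∧
      ∀ η : ℝ, 0 < η → ∃ A : ℝ, ∀ (F : T3Family) (γ : ℝ), F.L = L → 0 < γ → γ ≤ γ₁ →
        ∀ q : Plaq (F.P 0) 0, ∃ ρ : ℕ → ℝ,
          (∀ K : ℕ, ∑ k ∈ Finset.Ico 1 K, ρ k ≤ A + η * B10.pFun b₀ p₀ (Real.sqrt γ) ^ 2) ∧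
          ∀ K : ℕ, 1 ≤ K →
            (gibbsK F ℰp γ (K + 1)).real {U | θBal F.L γ b₀ p₀ 0 ≤ GaugeGroup.dist1 (GaugeField.plaqHol
                (Averaging.iter (fun i => BlockAveraging.blockAvg (P := F.P (K + 1)) (j := i) ℰp) (K + 1) U)
                (plaqShift (F.sitesPerDir_unit (K + 1)) q))} ≤
            Real.exp (ρ K) *
            (gibbsK F ℰp γ K).real {U | θBal F.L γ b₀ p₀ 0 ≤ GaugeGroup.dist1 (GaugeField.plaqHol
                (Averaging.iter (fun i => BlockAveraging.blockAvg (P := F.P K) (j := i) ℰp) K U)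
                (plaqShift (F.sitesPerDir_unit K) q))}) :
    Summit.QuantumFields.YangMills.Theses.SmallFieldWidening.LargeFieldMassRefinementTail :=
  largeFieldMassRefinementTail_of_unitTop (unitTop_of_plainStab hPS)

/-- **K2′ `HistoryTailL` (stmt-QuantumFields-19936) ⇐ `PlainStab`.**  Conditional certificate. [cite: Balaban1985UV3, (70)-(71) p.273] -/
theorem historyTailL_of_plainStab
    (hPS : ∀ (L : ℕ) (b₀ p₀ : ℝ), 0 < b₀ → 2 < p₀ → ∃ γ₁ : ℝ, 0 < γ₁ ∧ γ₁ ≤ 1 ∧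
      ∀ η : ℝ, 0 < η → ∃ A : ℝ, ∀ (F : T3Family) (γ : ℝ), F.L = L → 0 < γ → γ ≤ γ₁ →
        ∀ q : Plaq (F.P 0) 0, ∃ ρ : ℕ → ℝ,
          (∀ K : ℕ, ∑ k ∈ Finset.Ico 1 K, ρ k ≤ A + η * B10.pFun b₀ p₀ (Real.sqrt γ) ^ 2) ∧
          ∀ K : ℕ, 1 ≤ K →
            (gibbsK F ℰp γ (K + 1)).real {U | θBal F.L γ b₀ p₀ 0 ≤ GaugeGroup.dist1 (GaugeField.plaqHol
                (Averaging.iter (fun i => BlockAveraging.blockAvg (P := F.P (K + 1)) (j := i) ℰp) (K + 1) U)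
                (plaqShift (F.sitesPerDir_unit (K + 1)) q))} ≤
            Real.exp (ρ K) *
            (gibbsK F ℰp γ K).real {U | θBal F.L γ b₀ p₀ 0 ≤ GaugeGroup.dist1 (GaugeField.plaqHol
                (Averaging.iter (fun i => BlockAveraging.blockAvg (P := F.P K) (j := i) ℰp) K U)
                (plaqShift (F.sitesPerDir_unit K) q))}) :
    Summit.QuantumFields.YangMills.Theses.UnitScaleTilt.HistoryTailL :=
  historyTailL_of_unitTop (unitTop_of_plainStab hPS)

end Summit.QuantumFields.YangMills.Theorems.LargeFieldMassRefinementTailPlainStab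

end
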